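import Summits.Ventures.YMGap.RobustBall.LocalSourceScreening
import Summits.Ventures.YMGap.RobustBall.BoundaryDecay
import HarnessLib

/-!
# Venture YMGap, track ROBUST-BALL (Y2) — local sources are screened at the clustering rate: METRIC FORMS

HONEST FRAMING. WHAT THIS IS: a venture file (cell `pub-ymgap`, track Y2 ROBUST-BALL, seat rb-p1, theorems only), the
metric readings of `LocalSourceScreening.lean` (`abs_integral_sub_integral_le_of_source_profile`: Föllmer's comparison
with a localised defect for a member `(W, supp)` of the tier-1 `ℤ^d` ball — a Dobrushin contraction over
`perturbedNbr supp` with rows `≤ ρ < 1`, range `R` — against the member modified by ANY bounded source `V`).  For a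
source loading only the links of a finite set `S` and an observable on the link set `Δ` at `ℓ^∞`-distance
`d(Δ, S) = setDistEdges Δ S`:
* `abs_integral_sub_integral_le_of_source` — `|∫ f dμ − ∫ f dν| ≤ (√N/2 · min(B,4))/(1 − ρ) · ρ^{⌊d(Δ,S)/max(1,R)⌋} · Σ δ`
  (profile `⌊dist(·, S)/max(1,R)⌋`, which grows by at most `1` along the member's range);
* `abs_integral_sub_integral_le_of_source_exp` — the exponential reading with the clustering rate of `UniformMassGapKR`,
  `κ = −log max(ρ, 1/2)` (`e^{κ} ≤ 2`): `≤ (√N/2 · min(B,4))/(1 − max(ρ,½)) · e^{κ} · e^{−(κ/max(1,R)) d(Δ,S)} · Σ δ`;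
* `abs_integral_sub_integral_le_of_source_cylinder` — Shen–Zhu–Zhu's Lipschitz cylinder observables (`Σ δ = #Λ · K_F`);
* `screeningBound_linear` — bookkeeping for the clean readings (`1/2 ≤ ρ < 1`: `e^{κ} ≤ 2`, `κ ≥ 1 − ρ`).
READING: a static source / local change of the action at distance `D` from an observable moves its expectation by
`O(e^{−κ D/max(1,R)})` with a constant `≤ 2√N/(1 − max(ρ,½)) · e^{κ}` that does not see the strength of the source —
screening at the certified clustering rate.  WHAT THIS IS NOT: a one-sided Dobrushin-comparison bound; lattice strong
coupling only, nothing about the continuum limit or a Clay-sense mass gap.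

References (mechanism): H. Föllmer, LNM 1362 (1988), Ch. I, (2.8), (2.10), (2.23); H.-O. Georgii, *Gibbs Measures and
Phase Transitions* (2011), Thm. 8.20; L. Gross, J. Stat. Phys. 25 (1981) 57–72.
-/

noncomputable section

open MeasureTheory Function Finset ProbabilityTheory Real
open scoped NNReal
open Literature.Probability.LatticeModels
open Literature.Probability.LatticeModels.DobrushinMetric
open Literature.MathematicalPhysics.QuantumLattice
open Literature.MathematicalPhysics.QuantumFieldTheory hiding ZdEdge

namespace Summit.Ventures.YMGap.RobustBall

variable {d N : ℕ}

/-! ## §3 Metric forms: a source carried by a finite link set `S` -/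

/-- The distance profile `⌊dist(·, S)/max(1,R)⌋` grows by at most `1` along the member's range. -/
theorem floor_linkSetDist_le_succ {supp : Finset (ZdEdge d) → Finset (Finset (ZdEdge d))} {R : ℝ}
    (hR : ∀ e, ∀ X ∈ supp {e}, e ∈ X → ∀ y ∈ X, ‖e.1 - y.1‖ ≤ R) (S : Finset (ZdEdge d)) (x : ZdEdge d)
    {y : ZdEdge d} (hy : y ∈ perturbedNbr supp x) :
    ⌊linkSetDist S x / max 1 R⌋₊ ≤ ⌊linkSetDist S y / max 1 R⌋₊ + 1 := by
  have hR₀0 : (0 : ℝ) < max 1 R := zero_lt_one.trans_le (le_max_left _ _)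
  have h1 : linkSetDist S x / max 1 R ≤ linkSetDist S y / max 1 R + 1 := by
    rw [div_add_one hR₀0.ne', div_le_div_iff_of_pos_right hR₀0]
    exact (linkSetDist_le_add_norm S x y).trans (add_le_add le_rfl (norm_sub_le_of_mem_perturbedNbr hR x hy))
  calc ⌊linkSetDist S x / max 1 R⌋₊ ≤ ⌊linkSetDist S y / max 1 R + 1⌋₊ := Nat.floor_mono h1
    _ = ⌊linkSetDist S y / max 1 R⌋₊ + 1 := Nat.floor_add_one (div_nonneg (linkSetDist_nonneg _ _) hR₀0.le)

/-- **LOCAL SOURCES ARE SCREENED — metric form.**  As in the profile form, with a member of range `R` and a source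
that loads only links of a finite set `S` (`bV e ≤ 0` off `S`): for every bounded local `f` on `Δ`,
`|∫ f dμ − ∫ f dν| ≤ (√N/2 · min(B,4))/(1 − ρ) · ρ^{⌊d(Δ,S)/max(1,R)⌋} · Σ_{y ∈ Δ} δ_y`, `d(Δ,S) = setDistEdges Δ S`
the `ℓ^∞` distance between the observable's links and the source's links. -/
theorem abs_integral_sub_integral_le_of_source (hd : 1 ≤ d) {β ρ R : ℝ}
    {W : Potential (ZdEdge d) (Matrix.specialUnitaryGroup (Fin N) ℂ)} (hW : W.IsAdapted)
    (hWb : ∀ X, ∃ C, ∀ U, |W X U| ≤ C)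
    {supp : Finset (ZdEdge d) → Finset (Finset (ZdEdge d))} (hsupp : W.IsSupportedBy supp)
    (hR : ∀ e, ∀ X ∈ supp {e}, e ∈ X → ∀ y ∈ X, ‖e.1 - y.1‖ ≤ R)
    {C : ZdEdge d → ZdEdge d → ℝ}
    (hKR : IsKRContraction (perturbedYM (d := d) (fundamentalRep (Fin N)) (N * β) W supp) suFrobDist
      (perturbedNbr supp) C)
    (hrow : ∀ x, ∑ y ∈ perturbedNbr supp x, C x y ≤ ρ) (hρ : ρ < 1)
    {V : Potential (ZdEdge d) (Matrix.specialUnitaryGroup (Fin N) ℂ)} (hV : V.IsAdapted)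
    (hVb : ∀ X, ∃ C, ∀ U, |V X U| ≤ C)
    {suppV : Finset (ZdEdge d) → Finset (Finset (ZdEdge d))} (hsuppV : V.IsSupportedBy suppV)
    {oscV : Finset (ZdEdge d) → ZdEdge d → ℝ} (hoscV : ∀ X, Dobrushin.IsOscBound (V X) (oscV X))
    {bV : ZdEdge d → ℝ} (hbV : ∀ e, ∑ X ∈ (suppV {e}).filter (fun X => e ∈ X), oscV X e ≤ bV e)
    {B : ℝ} (hB : ∀ e, bV e ≤ B) {S : Finset (ZdEdge d)} (hS : ∀ e, e ∉ S → bV e ≤ 0)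
    {μ ν : Measure (LGConfig d (Matrix.specialUnitaryGroup (Fin N) ℂ))}
    (hμ : μ ∈ perturbedGibbsMeasures (d := d) (fundamentalRep (Fin N)) (N * β) W supp)
    (hν : ν ∈ perturbedGibbsMeasures (d := d) (fundamentalRep (Fin N)) (N * β) (W + V)
      (fun Λ => supp Λ ∪ suppV Λ))
    {f : LGConfig d (Matrix.specialUnitaryGroup (Fin N) ℂ) → ℝ} (hfm : Measurable f)
    {Δ : Finset (ZdEdge d)} (hfdep : DependsOn f (↑Δ : Set (ZdEdge d))) {M : ℝ} (hM : ∀ σ, |f σ| ≤ M)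
    {δ : ZdEdge d → ℝ} (hδ : IsLipBound suFrobDist f δ) :
    |(∫ σ, f σ ∂μ) - ∫ σ, f σ ∂ν| ≤
      Real.sqrt N / 2 * min B 4 / (1 - ρ) * ρ ^ ⌊setDistEdges Δ S / max 1 R⌋₊ * ∑ y ∈ Δ, δ y := by
  classical
  have hR₀0 : (0 : ℝ) < max 1 R := zero_lt_one.trans_le (le_max_left _ _)
  set ℓ : ZdEdge d → ℕ := fun y => ⌊linkSetDist S y / max 1 R⌋₊ with hℓ
  have hℓS : ∀ e, ℓ e ≠ 0 → bV e ≤ 0 := fun e he => hS e fun heS => he (by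
    simp [hℓ, linkSetDist_eq_zero_of_mem heS])
  have hℓ1 : ∀ x, ∀ y ∈ perturbedNbr supp x, ℓ x ≤ ℓ y + 1 := fun x y hy => floor_linkSetDist_le_succ hR S x hy
  have key := abs_integral_sub_integral_le_of_source_profile hd hW hWb hsupp hKR hrow hρ hV hVb hsuppV hoscV hbV hB
    ℓ hℓS hℓ1 hμ hν hfm hfdep hM hδ
  refine key.trans ?_
  -- nonnegativity of the constant
  have hC0 : ∀ x y, 0 ≤ C x y := hKR.nonneg
  have hρ0 : 0 ≤ ρ := by
    have hd0 : 0 < d := hd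
    let e₀ : ZdEdge d := (0, ⟨0, hd0⟩)
    exact (Finset.sum_nonneg fun y _ => hC0 e₀ y).trans (hrow e₀)
  have hbV0 : ∀ e, 0 ≤ bV e := fun e =>
    (Finset.sum_nonneg fun X _ => (hoscV X).nonneg e).trans (hbV e)
  have hK0 : 0 ≤ Real.sqrt N / 2 * min B 4 / (1 - ρ) := by
    have hd0 : 0 < d := hd
    have hB0 : 0 ≤ min B 4 := le_min ((hbV0 (0, ⟨0, hd0⟩)).trans (hB _)) (by norm_num)
    have : 0 < 1 - ρ := sub_pos.2 hρ
    positivity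
  have hmono : ∑ y ∈ Δ, ρ ^ ℓ y * δ y ≤ ∑ y ∈ Δ, ρ ^ ⌊setDistEdges Δ S / max 1 R⌋₊ * δ y :=
    Finset.sum_le_sum fun y hy => by
      have hm : ⌊setDistEdges Δ S / max 1 R⌋₊ ≤ ℓ y :=
        Nat.floor_mono (div_le_div_of_nonneg_right (setDistEdges_le_linkSetDist hy) hR₀0.le)
      exact mul_le_mul_of_nonneg_right (pow_le_pow_of_le_one hρ0 hρ.le hm) (hδ.nonneg y)
  calc Real.sqrt N / 2 * min B 4 / (1 - ρ) * ∑ y ∈ Δ, ρ ^ ℓ y * δ y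
      ≤ Real.sqrt N / 2 * min B 4 / (1 - ρ) * ∑ y ∈ Δ, ρ ^ ⌊setDistEdges Δ S / max 1 R⌋₊ * δ y :=
        mul_le_mul_of_nonneg_left hmono hK0
    _ = _ := by rw [← Finset.mul_sum]; ring

/-- **LOCAL SOURCES ARE SCREENED — exponential form with the clustering rate.**  With `κ = −log max(ρ, 1/2)` (the
rate of `UniformMassGapKR`; `e^{κ} ≤ 2`):
`|∫ f dμ − ∫ f dν| ≤ (√N/2 · min(B,4))/(1 − max(ρ,½)) · e^{κ} · e^{−(κ/max(1,R)) · d(Δ,S)} · Σ_{y ∈ Δ} δ_y` — a source at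
distance `D` from the observable moves its expectation by `O(e^{−κ D/max(1,R)})`, with a constant that does not see
the strength of the source. -/
theorem abs_integral_sub_integral_le_of_source_exp (hd : 1 ≤ d) {β ρ R : ℝ}
    {W : Potential (ZdEdge d) (Matrix.specialUnitaryGroup (Fin N) ℂ)} (hW : W.IsAdapted)
    (hWb : ∀ X, ∃ C, ∀ U, |W X U| ≤ C)
    {supp : Finset (ZdEdge d) → Finset (Finset (ZdEdge d))} (hsupp : W.IsSupportedBy supp)
    (hR : ∀ e, ∀ X ∈ supp {e}, e ∈ X → ∀ y ∈ X, ‖e.1 - y.1‖ ≤ R)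
    {C : ZdEdge d → ZdEdge d → ℝ}
    (hKR : IsKRContraction (perturbedYM (d := d) (fundamentalRep (Fin N)) (N * β) W supp) suFrobDist
      (perturbedNbr supp) C)
    (hrow : ∀ x, ∑ y ∈ perturbedNbr supp x, C x y ≤ ρ) (hρ : ρ < 1)
    {V : Potential (ZdEdge d) (Matrix.specialUnitaryGroup (Fin N) ℂ)} (hV : V.IsAdapted)
    (hVb : ∀ X, ∃ C, ∀ U, |V X U| ≤ C)
    {suppV : Finset (ZdEdge d) → Finset (Finset (ZdEdge d))} (hsuppV : V.IsSupportedBy suppV)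
    {oscV : Finset (ZdEdge d) → ZdEdge d → ℝ} (hoscV : ∀ X, Dobrushin.IsOscBound (V X) (oscV X))
    {bV : ZdEdge d → ℝ} (hbV : ∀ e, ∑ X ∈ (suppV {e}).filter (fun X => e ∈ X), oscV X e ≤ bV e)
    {B : ℝ} (hB : ∀ e, bV e ≤ B) {S : Finset (ZdEdge d)} (hS : ∀ e, e ∉ S → bV e ≤ 0)
    {μ ν : Measure (LGConfig d (Matrix.specialUnitaryGroup (Fin N) ℂ))}
    (hμ : μ ∈ perturbedGibbsMeasures (d := d) (fundamentalRep (Fin N)) (N * β) W supp)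
    (hν : ν ∈ perturbedGibbsMeasures (d := d) (fundamentalRep (Fin N)) (N * β) (W + V)
      (fun Λ => supp Λ ∪ suppV Λ))
    {f : LGConfig d (Matrix.specialUnitaryGroup (Fin N) ℂ) → ℝ} (hfm : Measurable f)
    {Δ : Finset (ZdEdge d)} (hfdep : DependsOn f (↑Δ : Set (ZdEdge d))) {M : ℝ} (hM : ∀ σ, |f σ| ≤ M)
    {δ : ZdEdge d → ℝ} (hδ : IsLipBound suFrobDist f δ) :
    |(∫ σ, f σ ∂μ) - ∫ σ, f σ ∂ν| ≤
      Real.sqrt N / 2 * min B 4 / (1 - max ρ (1 / 2)) * exp (-Real.log (max ρ (1 / 2))) *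
        exp (-(-Real.log (max ρ (1 / 2)) / max 1 R) * setDistEdges Δ S) * ∑ y ∈ Δ, δ y := by
  set c' : ℝ := max ρ (1 / 2) with hc'
  have hc'0 : 0 < c' := lt_max_of_lt_right (by norm_num)
  have hc'1 : c' < 1 := max_lt hρ (by norm_num)
  have hrow' : ∀ x, ∑ y ∈ perturbedNbr supp x, C x y ≤ c' := fun x => (hrow x).trans (le_max_left _ _)
  have key := abs_integral_sub_integral_le_of_source hd hW hWb hsupp hR hKR hrow' hc'1 hV hVb hsuppV hoscV hbV hB
    hS hμ hν hfm hfdep hM hδ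
  refine key.trans ?_
  set κ : ℝ := -Real.log c' with hκ
  have hκ0 : 0 < κ := neg_pos.2 (Real.log_neg hc'0 hc'1)
  set R₀ : ℝ := max 1 R with hR₀
  have hR₀0 : 0 < R₀ := zero_lt_one.trans_le (le_max_left _ _)
  have hbV0 : ∀ e, 0 ≤ bV e := fun e =>
    (Finset.sum_nonneg fun X _ => (hoscV X).nonneg e).trans (hbV e)
  have hK0 : 0 ≤ Real.sqrt N / 2 * min B 4 / (1 - c') := by
    have hd0 : 0 < d := hd
    have hB0 : 0 ≤ min B 4 := le_min ((hbV0 (0, ⟨0, hd0⟩)).trans (hB _)) (by norm_num)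
    have : 0 < 1 - c' := sub_pos.2 hc'1
    positivity
  have hδ0 : 0 ≤ ∑ y ∈ Δ, δ y := Finset.sum_nonneg fun y _ => hδ.nonneg y
  have hgeom : c' ^ ⌊setDistEdges Δ S / R₀⌋₊ ≤ exp κ * exp (-(κ / R₀) * setDistEdges Δ S) := by
    have hfl : setDistEdges Δ S / R₀ - 1 ≤ (⌊setDistEdges Δ S / R₀⌋₊ : ℝ) := by
      have := Nat.lt_floor_add_one (setDistEdges Δ S / R₀)
      linarith
    rw [← exp_add, ← Real.rpow_natCast, Real.rpow_def_of_pos hc'0]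
    refine exp_le_exp.2 ?_
    have hlog : Real.log c' = -κ := by rw [hκ, neg_neg]
    rw [hlog]
    have := mul_le_mul_of_nonneg_left hfl hκ0.le
    have e1 : -(κ / R₀) * setDistEdges Δ S = -(κ * (setDistEdges Δ S / R₀)) := by
      field_simp
    rw [e1]
    linarith
  calc Real.sqrt N / 2 * min B 4 / (1 - c') * c' ^ ⌊setDistEdges Δ S / R₀⌋₊ * ∑ y ∈ Δ, δ y
      ≤ Real.sqrt N / 2 * min B 4 / (1 - c') * (exp κ * exp (-(κ / R₀) * setDistEdges Δ S)) * ∑ y ∈ Δ, δ y := by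
        gcongr
    _ = _ := by ring

/-- Bookkeeping for the clean readings: for `1/2 ≤ ρ < 1` the constant `e^{κ}/(1 − max(ρ,½)) ≤ 2/(1 − ρ)` and the
rate `κ/max(1,R) ≥ (1 − ρ)/max(1,R)` (`−log ρ ≥ 1 − ρ`). -/
theorem screeningBound_linear {A m ρ R D : ℝ} (hA : 0 ≤ A) (hm : 0 ≤ m) (hhalf : 1 / 2 ≤ ρ) (hρ1 : ρ < 1)
    (hD : 0 ≤ D) :
    A * m / (1 - max ρ (1 / 2)) * exp (-Real.log (max ρ (1 / 2))) *
        exp (-(-Real.log (max ρ (1 / 2)) / max 1 R) * D) ≤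
      2 * A * m / (1 - ρ) * exp (-((1 - ρ) / max 1 R) * D) := by
  have hmax : max ρ (1 / 2) = ρ := max_eq_left hhalf
  rw [hmax]
  have hρ0 : 0 < ρ := by linarith
  have h1ρ : 0 < 1 - ρ := sub_pos.2 hρ1
  have hR₀ : 0 < max 1 R := zero_lt_one.trans_le (le_max_left _ _)
  have hexp : exp (-Real.log ρ) ≤ 2 := by
    rw [Real.exp_neg, Real.exp_log hρ0, inv_le_comm₀ hρ0 (by norm_num : (0 : ℝ) < 2)]
    linarith
  have hlog : 1 - ρ ≤ -Real.log ρ := by linarith [Real.log_le_sub_one_of_pos hρ0]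
  have hrate : exp (-(-Real.log ρ / max 1 R) * D) ≤ exp (-((1 - ρ) / max 1 R) * D) := by
    refine exp_le_exp.2 ?_
    have := mul_le_mul_of_nonneg_right (div_le_div_of_nonneg_right hlog hR₀.le) hD
    linarith
  calc A * m / (1 - ρ) * exp (-Real.log ρ) * exp (-(-Real.log ρ / max 1 R) * D)
      ≤ A * m / (1 - ρ) * 2 * exp (-((1 - ρ) / max 1 R) * D) := by
        gcongr
    _ = 2 * A * m / (1 - ρ) * exp (-((1 - ρ) / max 1 R) * D) := by ring

/-! ## §4 Lipschitz-cylinder form (Shen–Zhu–Zhu's observable class) -/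

/-- **LOCAL SOURCES ARE SCREENED — Lipschitz-cylinder form.**  For a Lipschitz cylinder observable `F` with link
support `Λ` and constant `K_F` (entry metric), at `ℓ^∞`-distance `d(Λ, S)` from the links carrying the source:
`|∫ F dμ − ∫ F dν| ≤ (√N/2 · min(B,4))/(1 − max(ρ,½)) · e^{κ} · e^{−(κ/max(1,R)) d(Λ,S)} · #Λ · K_F`,
`κ = −log max(ρ, 1/2)`. -/
theorem abs_integral_sub_integral_le_of_source_cylinder (hd : 1 ≤ d) {β ρ R : ℝ}
    {W : Potential (ZdEdge d) (Matrix.specialUnitaryGroup (Fin N) ℂ)} (hW : W.IsAdapted)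
    (hWb : ∀ X, ∃ C, ∀ U, |W X U| ≤ C)
    {supp : Finset (ZdEdge d) → Finset (Finset (ZdEdge d))} (hsupp : W.IsSupportedBy supp)
    (hR : ∀ e, ∀ X ∈ supp {e}, e ∈ X → ∀ y ∈ X, ‖e.1 - y.1‖ ≤ R)
    {C : ZdEdge d → ZdEdge d → ℝ}
    (hKR : IsKRContraction (perturbedYM (d := d) (fundamentalRep (Fin N)) (N * β) W supp) suFrobDist
      (perturbedNbr supp) C)
    (hrow : ∀ x, ∑ y ∈ perturbedNbr supp x, C x y ≤ ρ) (hρ : ρ < 1)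
    {V : Potential (ZdEdge d) (Matrix.specialUnitaryGroup (Fin N) ℂ)} (hV : V.IsAdapted)
    (hVb : ∀ X, ∃ C, ∀ U, |V X U| ≤ C)
    {suppV : Finset (ZdEdge d) → Finset (Finset (ZdEdge d))} (hsuppV : V.IsSupportedBy suppV)
    {oscV : Finset (ZdEdge d) → ZdEdge d → ℝ} (hoscV : ∀ X, Dobrushin.IsOscBound (V X) (oscV X))
    {bV : ZdEdge d → ℝ} (hbV : ∀ e, ∑ X ∈ (suppV {e}).filter (fun X => e ∈ X), oscV X e ≤ bV e)
    {B : ℝ} (hB : ∀ e, bV e ≤ B) {S : Finset (ZdEdge d)} (hS : ∀ e, e ∉ S → bV e ≤ 0)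
    {μ ν : Measure (LGConfig d (Matrix.specialUnitaryGroup (Fin N) ℂ))}
    (hμ : μ ∈ perturbedGibbsMeasures (d := d) (fundamentalRep (Fin N)) (N * β) W supp)
    (hν : ν ∈ perturbedGibbsMeasures (d := d) (fundamentalRep (Fin N)) (N * β) (W + V)
      (fun Λ => supp Λ ∪ suppV Λ))
    {F : LGConfig d (Matrix.specialUnitaryGroup (Fin N) ℂ) → ℝ} {Λ : Finset (ZdEdge d)} {KF : ℝ≥0}
    (hF : IsLipschitzCylinder (fundamentalRep (Fin N)) F Λ KF) :
    |(∫ σ, F σ ∂μ) - ∫ σ, F σ ∂ν| ≤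
      Real.sqrt N / 2 * min B 4 / (1 - max ρ (1 / 2)) * exp (-Real.log (max ρ (1 / 2))) *
        exp (-(-Real.log (max ρ (1 / 2)) / max 1 R) * setDistEdges Λ S) * (Λ.card * KF) := by
  classical
  have hA : ∀ a b : Matrix.specialUnitaryGroup (Fin N) ℂ,
      dist (suEntries a) (suEntries b) ≤ 1 * suFrobDist a b :=
    fun a b => by rw [one_mul]; exact dist_suEntries_le_suFrobDist a b
  have key := abs_integral_sub_integral_le_of_source_exp hd hW hWb hsupp hR hKR hrow hρ hV hVb hsuppV hoscV hbV hB
    hS hμ hν hF.measurable hF.dependsOn hF.abs_le (hF.isLipBound zero_le_one hA)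
  have hsum : ∑ y ∈ Λ, (if y ∈ Λ then (1 : ℝ) * (KF : ℝ) else 0) = Λ.card * KF := by
    rw [Finset.sum_ite_of_true (fun y hy => hy), Finset.sum_const, nsmul_eq_mul, one_mul]
  rw [hsum] at key
  exact key

end Summit.Ventures.YMGap.RobustBall

end
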